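import Literature.Computability.AlgebraicComplexity.BurgisserRootCountGRH
import Literature.NumberTheory.LFunctions.GRHPrimeIdealCountLowerBound
import HarnessLib

/-!
# Bürgisser's Theorem 4.1 from Theorem 4.5 alone (the GRH input proved)

Trunk T-CPLX-ALG. Bürgisser, *Cook's versus Valiant's hypothesis*, TCS 235 (2000), Thm. 4.1
(`reduction_mod_primes_of_GRH`, `BurgisserBooleanParts.lean`): under GRH, an integer system of
degree `≤ d`, `n < d` unknowns, weight `≤ w`, solvable over `ℂ`, is solvable modulo at least
`π(x)/d^{O(n)} − O(x^{1/2} log(wx))` primes `p ≤ x`. The tree proves it from TWO named facts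
(`reduction_mod_primes_of_GRH_of_heightBound_of_effectivePrimeIdealTheorem`,
`BurgisserRootCountGRH.lean`): Krick–Pardo's height bound (TCS Thm. 4.5,
`algebraicSolution_height_bound`) and the effective prime ideal theorem under GRH
(`effectivePrimeIdealTheorem_of_ERH`, Lagarias–Odlyzko/Serre). This file REMOVES the second input:

* `rootModPrimeCount_lower_bound_weak_of_erh` — **a weak Corollary 4.8, proved**: under ERH, for
  every irreducible `g ∈ ℤ[Y]` of degree `D ≥ 1` and weight `≤ w`, and every `x`,
  `π_g(x) ≥ π(x)/(10 D) − K (√x log(Dwx) + D log(Dw))` with an absolute `K`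
  (`= 4 (grhPsiConst + 3)`). This is Bürgisser's Cor. 4.8 with the main term `π(x)/D` weakened
  by the absolute factor `10`; it follows from the PROVED GRH-conditional lower bound for the number
  of prime ideals `π_K(x) ≥ x/(2 log x) − (C+2)(log|d_K| + n_K)√x`
  (`primeIdealCount_ge_of_erh`, `GRHPrimeIdealCountLowerBound.lean`: Riesz-mean Perron formula,
  Rademacher convexity, Jensen, Landau's lemma — all uniform in the field) by the counting of
  `BurgisserRootCountGRH.lean` (degree-one primes of the stem field give roots modulo `p`) and
  Chebyshev's `π(x) ≤ 5x/log x`.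
* `reduction_mod_primes_of_GRH_of_heightBound` — **Theorem 4.1 from Theorem 4.5**: the weakened
  main term is absorbed into the `d^{O(n)}` of Thm. 4.1 (bookkeeping `thm41_junk`/`thm41_absorb` of
  `BurgisserReductionModPrimes.lean` with `a` enlarged so that `20a ≤ 2^a ≤ d^{an}`), so that
  `reduction_mod_primes_of_GRH` now rests on the single external theorem
  `algebraicSolution_height_bound` (TCS Thm. 4.5, Krick–Pardo + Bézout).

## References

* P. Bürgisser, *Cook's versus Valiant's hypothesis*, Theoret. Comput. Sci. 235 (2000) 71–88,
  §4: Thm. 4.1 (p. 79), Thm. 4.5 (p. 82), Thm. 4.7 / Cor. 4.8 (pp. 83–84) (`Burgisser2000TCS`).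
* J. C. Lagarias, A. M. Odlyzko, *Effective versions of the Chebotarev density theorem* (1977),
  Thm. 1.1 (`LagariasOdlyzko1977`).
-/

noncomputable section

open scoped Classical NumberField
open Polynomial Finset Literature.NumberTheory.LFunctions
  Literature.NumberTheory.LFunctions.NumberField

namespace Literature.Computability.AlgebraicComplexity

/-! ### The real bookkeeping of the weak Corollary 4.8 -/

/-- The linear-combination step: from `π_K ≤ D(N + ω) + D s`,
`X/(2 lx) − (C+2)(ldK + D) S ≤ π_K`, `πx ≤ 5X/lx`, `ldK ≤ D log D + 2D log W`, `ω ≤ 2(lD + lW)`,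
`s ≤ S` (with `D ≥ 1`, `lx ≥ 1/2`, `lD, lW ≥ 0`) conclude
`πx/(10D) − 4(C+3)(S(lD + lW + lx) + D(lD + lW)) ≤ N`. [folklore] -/
theorem cor48_weak_bookkeeping {C D S X lx ldK lD lW ω s N πx πK : ℝ} (hC : 0 ≤ C) (hD : 1 ≤ D)
    (hS : 0 ≤ S) (hlx : 1 / 2 ≤ lx) (hlD : 0 ≤ lD) (hlW : 0 ≤ lW)
    (h1 : πK ≤ D * (N + ω) + D * s) (h2 : X / (2 * lx) - (C + 2) * (ldK + D) * S ≤ πK)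
    (h3 : πx ≤ 5 * X / lx) (h4 : ldK ≤ D * lD + 2 * D * lW) (h5 : ω ≤ 2 * (lD + lW))
    (h6 : s ≤ S) :
    πx / (10 * D) - 4 * (C + 3) * (S * (lD + lW + lx) + D * (lD + lW)) ≤ N := by
  have hDpos : 0 < D := by linarith
  have hlxpos : 0 < lx := by linarith
  -- `N ≥ πK/D − ω − S`
  have hN : πK / D - ω - S ≤ N := by
    have h' : πK ≤ D * (N + ω + S) := by nlinarith
    have : πK / D ≤ N + ω + S := by rw [div_le_iff₀ hDpos]; linarith
    linarith
  -- `πK/D ≥ X/(2 D lx) − (C+2)(ldK/D + 1) S`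
  have hK : X / (2 * lx) / D - (C + 2) * (ldK / D + 1) * S ≤ πK / D := by
    have e : X / (2 * lx) / D - (C + 2) * (ldK / D + 1) * S =
        (X / (2 * lx) - (C + 2) * (ldK + D) * S) / D := by
      field_simp
    rw [e]
    exact div_le_div_of_nonneg_right h2 hDpos.le
  -- `ldK/D ≤ lD + 2 lW`
  have hld : ldK / D ≤ lD + 2 * lW := by
    rw [div_le_iff₀ hDpos]; linarith
  -- main term: `πx/(10 D) ≤ X/(2 lx)/D`
  have hmain : πx / (10 * D) ≤ X / (2 * lx) / D := by
    rw [div_div, div_le_div_iff₀ (by positivity) (by positivity)]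
    have : πx * lx ≤ 5 * X := by rwa [le_div_iff₀ hlxpos] at h3
    nlinarith
  -- junk
  have hCS : 0 ≤ (C + 2) * S := by positivity
  have hj1 : (C + 2) * (ldK / D + 1) * S ≤ (C + 2) * (lD + 2 * lW + 1) * S := by
    have := mul_le_mul_of_nonneg_left (add_le_add_right hld 1) hCS
    nlinarith
  have hj2 : (C + 2) * (lD + 2 * lW + 1) * S + S + 2 * (lD + lW) ≤
      4 * (C + 3) * (S * (lD + lW + lx) + D * (lD + lW)) := by
    have e1 : (C + 2) * (lD + 2 * lW + 1) + 1 ≤ 2 * (C + 3) * (lD + lW + lx) := by nlinarith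
    have e2 : 2 * (lD + lW) ≤ 4 * (C + 3) * (D * (lD + lW)) := by
      have h12 : 2 ≤ 4 * (C + 3) * D := by nlinarith
      have := mul_le_mul_of_nonneg_right h12 (add_nonneg hlD hlW)
      linarith
    have e3 : ((C + 2) * (lD + 2 * lW + 1) + 1) * S ≤ 2 * (C + 3) * (lD + lW + lx) * S :=
      mul_le_mul_of_nonneg_right e1 hS
    nlinarith
  linarith

/-- Junk case `x ≤ 1` of the weak Cor. 4.8. [folklore] -/
theorem cor48_weak_small {K D W : ℝ} (hK : 0 ≤ K) (hD : 1 ≤ D) (hW : 1 ≤ W) {x : ℕ} (hx : x < 2)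
    {N : ℝ} (hN : 0 ≤ N) :
    (Nat.primeCounting x : ℝ) / (10 * D) -
        K * (Real.sqrt x * Real.log (D * W * x) + D * Real.log (D * W)) ≤ N := by
  have h := cor48_small hK hD hW hx hN
  have hπ : Nat.primeCounting x = 0 := by
    interval_cases x <;> decide
  rw [hπ, Nat.cast_zero, zero_div] at h ⊢
  exact h

/-! ### The weak Corollary 4.8, proved under ERH -/

/-- **A weak form of Bürgisser's Corollary 4.8, proved** (Bürgisser 2000 TCS, Cor. 4.8 p. 84 has
`π_g(x) ≥ π(x)/d − O(x^{1/2} log(dwx) + d log(dw))` from the effective prime ideal theorem; here the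
main term carries the extra absolute factor `1/10`): under ERH, there is an absolute `K ≥ 0` such
that for every irreducible `g ∈ ℤ[Y]` of degree `d ≥ 1` and weight `≤ w` and every `x`,
`π_g(x) ≥ π(x)/(10 d) − K (x^{1/2} log(dwx) + d log(dw))`.
Inputs, all proved: the GRH lower bound for prime ideals of the stem field
(`primeIdealCount_ge_of_erh`), the counting `π_K(x) ≤ d(π_g(x) + ω(a_d)) + d√x` and the
discriminant bound `log|d_K| ≤ d log d + 2d log w` of `BurgisserRootCountGRH.lean` /
`DegreeOnePrimesDiscriminantBound.lean`, and Chebyshev's `π(x) ≤ 5x/log x`.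
[cite: Burgisser2000TCS, Cor. 4.8 p. 84] -/
theorem rootModPrimeCount_lower_bound_weak_of_erh
    (hERH : Literature.NumberTheory.LFunctions.ExtendedRiemannHypothesis) :
    ∃ K : ℝ, 0 ≤ K ∧ ∀ (g : ℤ[X]) (w : ℕ), Irreducible g → 0 < g.natDegree →
      polyWeight g ≤ w → ∀ x : ℕ,
        (Nat.primeCounting x : ℝ) / (10 * g.natDegree) -
            K * (Real.sqrt x * Real.log (g.natDegree * w * x) +
              g.natDegree * Real.log (g.natDegree * w)) ≤
          (rootModPrimeCount g x : ℝ) := by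
  set C : ℝ := grhPsiConst with hC
  have hC0 : 0 ≤ C := grhPsiConst_pos.le
  refine ⟨4 * (C + 3), by positivity, ?_⟩
  intro g w hirr hdeg hw x
  have hprim : g.IsPrimitive := hirr.isPrimitive hdeg.ne'
  haveI : Fact (Irreducible (g.map (algebraMap ℤ ℚ))) :=
    ⟨(IsPrimitive.Int.irreducible_iff_irreducible_map_cast hprim).mp hirr⟩
  set D : ℝ := (g.natDegree : ℝ) with hD
  set W : ℝ := (w : ℝ) with hW
  have hD1 : 1 ≤ D := by rw [hD]; exact_mod_cast hdeg
  have hw1 : 1 ≤ polyWeight g := one_le_polyWeight hirr.ne_zero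
  have hW1 : 1 ≤ W := by rw [hW]; exact_mod_cast hw1.trans hw
  have hN0 : (0 : ℝ) ≤ rootModPrimeCount g x := Nat.cast_nonneg _
  by_cases hx : x < 2
  · exact cor48_weak_small (by positivity) hD1 hW1 hx hN0
  have hx2 : 2 ≤ x := not_lt.mp hx
  have hX2 : (2 : ℝ) ≤ (x : ℝ) := by exact_mod_cast hx2
  have hWsum : ∑ i ∈ range (g.natDegree + 1), |(g.coeff i : ℝ)| ≤ W := by
    rw [sum_abs_coeff_eq_polyWeight, hW]
    exact_mod_cast hw
  -- (F1) the GRH lower bound for the prime ideals of the stem field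
  have hfin : Module.finrank ℚ (DegreeOnePrimes.RootField g) = g.natDegree :=
    DegreeOnePrimes.finrank_rootField g
  have HK := primeIdealCount_ge_of_erh (K := DegreeOnePrimes.RootField g)
    (hERH (DegreeOnePrimes.RootField g)) hX2
  rw [hfin] at HK
  -- (F2) Chebyshev for `ℚ`
  have HQ := primeCounting_le_five_mul_div_log hX2
  rw [Nat.floor_natCast] at HQ
  -- (F3) the discriminant of the stem field
  have hdisc := DegreeOnePrimes.log_abs_discr_rootField_le (g := g) hWsum
  have hnatAbs : Real.log (((NumberField.discr (DegreeOnePrimes.RootField g)).natAbs : ℕ) : ℝ) =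
      Real.log |(NumberField.discr (DegreeOnePrimes.RootField g) : ℝ)| := by
    rw [Nat.cast_natAbs, Int.cast_abs]
  rw [hnatAbs] at HK
  -- (F4) counting prime ideals
  have hcount : (primeIdealCount (DegreeOnePrimes.RootField g) (x : ℝ) : ℝ) ≤
      D * (rootModPrimeCount g x + (g.leadingCoeff.natAbs).primeFactors.card) +
        D * Nat.sqrt x := by
    have h := (primeIdealCount_le_card_degreeOnePrimesLE (DegreeOnePrimes.RootField g) x).trans
      (Nat.add_le_add_right
        (Nat.mul_le_mul_left _ (card_degreeOnePrimesLE_rootField_le g x)) _)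
    rw [hfin] at h
    rw [hD]
    exact_mod_cast h
  -- (F5) the exceptional primes
  have hω : ((g.leadingCoeff.natAbs).primeFactors.card : ℝ) ≤ 2 * (Real.log D + Real.log W) := by
    have ha0 : 0 < g.leadingCoeff.natAbs :=
      Int.natAbs_pos.mpr (Polynomial.leadingCoeff_ne_zero.mpr
        (DegreeOnePrimes.ne_zero_of_fact_irreducible g))
    have h1 := card_primeFactors_mul_log_two_le ha0
    have hDpos : 0 < D := by linarith
    have hWpos : 0 < W := by linarith
    have h2 : Real.log (g.leadingCoeff.natAbs : ℝ) ≤ Real.log D + Real.log W := by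
      rw [← Real.log_mul hDpos.ne' hWpos.ne']
      refine Real.log_le_log (by exact_mod_cast ha0) ?_
      rw [Nat.cast_natAbs, Int.cast_abs]
      calc |((g.leadingCoeff : ℤ) : ℝ)| ≤ W := DegreeOnePrimes.abs_leadingCoeff_le hWsum
        _ = 1 * W := (one_mul W).symm
        _ ≤ D * W := mul_le_mul_of_nonneg_right hD1 (by linarith)
    have hlog2 : (1 : ℝ) / 2 < Real.log 2 := by
      have := Real.log_two_gt_d9
      linarith
    have h0 : (0 : ℝ) ≤ (g.leadingCoeff.natAbs).primeFactors.card := Nat.cast_nonneg _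
    nlinarith
  -- (F6) `⌊√x⌋ ≤ √x`
  have hsqrt : ((Nat.sqrt x : ℕ) : ℝ) ≤ Real.sqrt (x : ℝ) := by
    calc ((Nat.sqrt x : ℕ) : ℝ) = Real.sqrt (((Nat.sqrt x : ℕ) : ℝ) ^ 2) :=
          (Real.sqrt_sq (Nat.cast_nonneg _)).symm
      _ ≤ Real.sqrt (x : ℝ) := Real.sqrt_le_sqrt (by exact_mod_cast Nat.sqrt_le' x)
  -- logarithms
  have hDpos : 0 < D := by linarith
  have hWpos : 0 < W := by linarith
  have hxpos : (0 : ℝ) < x := by linarith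
  have hlogD : 0 ≤ Real.log D := Real.log_nonneg hD1
  have hlogW : 0 ≤ Real.log W := Real.log_nonneg hW1
  have hlX : 1 / 2 ≤ Real.log (x : ℝ) := by
    have := Real.log_two_gt_d9
    have h := Real.log_le_log two_pos hX2
    linarith
  have hdisc' : Real.log |(NumberField.discr (DegreeOnePrimes.RootField g) : ℝ)| ≤
      D * Real.log D + 2 * D * Real.log W := by rw [hD]; exact hdisc
  -- assemble
  have hgoal := cor48_weak_bookkeeping (πx := (Nat.primeCounting x : ℝ)) (X := (x : ℝ))
    (N := (rootModPrimeCount g x : ℝ)) hC0 hD1 (Real.sqrt_nonneg (x : ℝ)) hlX hlogD hlogW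
    hcount HK HQ hdisc' hω hsqrt
  have hlogDWX : Real.log (D * W * x) = Real.log D + Real.log W + Real.log (x : ℝ) := by
    rw [Real.log_mul (mul_pos hDpos hWpos).ne' hxpos.ne', Real.log_mul hDpos.ne' hWpos.ne']
  have hlogDW : Real.log (D * W) = Real.log D + Real.log W := Real.log_mul hDpos.ne' hWpos.ne'
  rw [hlogDWX, hlogDW]
  exact hgoal

/-! ### Theorem 4.1 from Theorem 4.5 -/

/-- `20 a ≤ 2 ^ a` for `a ≥ 8`. [folklore] -/
theorem twenty_mul_le_two_pow {a : ℕ} (ha : 8 ≤ a) : 20 * a ≤ 2 ^ a := by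
  induction a, ha using Nat.le_induction with
  | base => norm_num
  | succ a ha ih =>
      have h32 : 20 ≤ 2 ^ a := le_trans (by norm_num) (Nat.pow_le_pow_right two_pos (by omega : 5 ≤ a))
      rw [pow_succ]; omega

/-- **Theorem 4.1 from Theorem 4.5** (Bürgisser 2000 TCS, Thm. 4.1 p. 79, "by combining
Theorem 4.5, Remark 4.6, and Corollary 4.8", p. 84): the named fact
`reduction_mod_primes_of_GRH` — under GRH, `π_S(x) ≥ π(x)/d^{O(n)} − O(x^{1/2} log(wx))` for
integer systems of degree `≤ d`, `n < d` unknowns, weight `≤ w`, solvable over `ℂ` — follows from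
the Krick–Pardo height bound `algebraicSolution_height_bound` (TCS Thm. 4.5) ALONE, the
GRH-conditional prime count (a weak Cor. 4.8, `rootModPrimeCount_lower_bound_weak_of_erh`) being
proved in the tree. Bookkeeping as in `reduction_mod_primes_of_GRH_of_facts`
(`BurgisserReductionModPrimes.lean`), with the Thm. 4.5 constant `a` enlarged to `≥ 8` so that the
weakened main term `π(x)/(10 A)`, `A = a d^{an}`, is absorbed: `2 · (10a) ≤ 2^a ≤ d^{an}`; the
constants are `c = 4a`, `C = 2 (7K + 2) (10a)² + 1`.
[cite: Burgisser2000TCS, Thm. 4.1 p. 79 and §4 p. 84] -/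
theorem reduction_mod_primes_of_GRH_of_heightBound (h45 : algebraicSolution_height_bound) :
    reduction_mod_primes_of_GRH := by
  intro hERH
  obtain ⟨a₀, h45⟩ := h45
  obtain ⟨K, hK0, h48⟩ := rootModPrimeCount_lower_bound_weak_of_erh hERH
  obtain ⟨a, ha8, ha0⟩ : ∃ a : ℕ, 8 ≤ a ∧ a₀ ≤ a := ⟨max a₀ 8, le_max_right _ _, le_max_left _ _⟩
  have ha1 : 1 ≤ a := by omega
  have hC0 : (0 : ℝ) ≤ 2 * (7 * K + 2) * (10 * (a : ℝ)) ^ 2 + 1 := by positivity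
  refine ⟨((4 * a : ℕ) : ℝ), 2 * (7 * K + 2) * (10 * (a : ℝ)) ^ 2 + 1, by positivity, hC0, ?_⟩
  intro n s d w S hnd hdeg hwt hsol x
  rw [show ((4 * a : ℕ) : ℝ) * (n : ℝ) = ((4 * a * n : ℕ) : ℝ) by push_cast; ring,
    Real.rpow_natCast]
  have hL0 : 0 ≤ Real.log ((w : ℝ) * x) := by
    rw [← Nat.cast_mul]; exact Real.log_natCast_nonneg _
  have hsx0 : 0 ≤ Real.sqrt (x : ℝ) := Real.sqrt_nonneg _
  have hCT : 0 ≤ (2 * (7 * K + 2) * (10 * (a : ℝ)) ^ 2 + 1) * Real.sqrt x * Real.log ((w : ℝ) * x) :=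
    mul_nonneg (mul_nonneg hC0 hsx0) hL0
  have hπS0 : (0 : ℝ) ≤ solvableModPrimeCount S x := Nat.cast_nonneg _
  have hπ0 : (0 : ℝ) ≤ Nat.primeCounting x := Nat.cast_nonneg _
  have hd1 : 1 ≤ d := by omega
  -- degenerate case: the zero system (`π_S = π`)
  by_cases hzero : ∀ i, S i = 0
  · rw [solvableModPrimeCount_of_forall_eq_zero S hzero]
    have h1 : (Nat.primeCounting x : ℝ) / (d : ℝ) ^ (4 * a * n) ≤ Nat.primeCounting x :=
      div_le_self hπ0 (one_le_pow₀ (by exact_mod_cast hd1))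
    linarith
  push Not at hzero
  obtain ⟨i₀, hi₀⟩ := hzero
  -- hence `n ≥ 1`, `w ≥ 1`, `d ≥ 2`
  have hn : 1 ≤ n := by
    rcases Nat.eq_zero_or_pos n with rfl | h
    · obtain ⟨z, hz⟩ := hsol
      exact absurd (eq_zero_of_solvable_of_isEmpty (hz i₀)) hi₀
    · exact h
  have hw : 1 ≤ w := by
    by_contra hw0
    exact hi₀ (eq_zero_of_weight_eq_zero (by have := hwt i₀; omega))
  have hd2 : 2 ≤ d := by omega
  -- degenerate case: `x ≤ 1` (`π(x) = 0`)
  by_cases hx2 : x < 2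
  · have hπ : Nat.primeCounting x = 0 := Nat.primeCounting_eq_zero_iff.2 (by omega)
    rw [hπ, Nat.cast_zero, zero_div]
    linarith
  push Not at hx2
  -- the main case: `x ≥ 2`
  have hx1 : (1 : ℝ) ≤ x := by exact_mod_cast (show 1 ≤ x by omega)
  have hxpos : (0 : ℝ) < x := by linarith
  have hwpos : (0 : ℝ) < w := by exact_mod_cast hw
  have hsx1 : 1 ≤ Real.sqrt (x : ℝ) := by
    rw [← Real.sqrt_one]; exact Real.sqrt_le_sqrt hx1
  have hlog2 : (1 : ℝ) / 2 ≤ Real.log 2 := by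
    have := Real.log_two_gt_d9; linarith
  have hlogw0 : 0 ≤ Real.log w := Real.log_nonneg (by exact_mod_cast hw)
  have hlogx0 : 0 ≤ Real.log x := Real.log_nonneg hx1
  have hLsplit : Real.log ((w : ℝ) * x) = Real.log w + Real.log x :=
    Real.log_mul hwpos.ne' hxpos.ne'
  have hlogwL : Real.log w ≤ Real.log ((w : ℝ) * x) := by linarith
  have hlogxL : Real.log x ≤ Real.log ((w : ℝ) * x) := by linarith
  have hL2 : 1 / 2 ≤ Real.log ((w : ℝ) * x) := by
    have : Real.log 2 ≤ Real.log x := Real.log_le_log two_pos (by exact_mod_cast hx2)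
    linarith
  -- Theorem 4.5: the algebraic solution
  obtain ⟨lam, v, g, y, hlam, hirr, hprim, hdg, hgy, hsolv, hdegg, -, hloglam, hlogwg, -⟩ :=
    h45 n s d w S hnd hdeg hwt hsol
  -- `D = d^{an} ≥ 20a`, `A = a D`
  obtain ⟨D, hD⟩ : ∃ D : ℝ, D = (d : ℝ) ^ (a * n) := ⟨_, rfl⟩
  have ha1' : (1 : ℝ) ≤ a := by exact_mod_cast ha1
  have hD20a : 2 * (10 * (a : ℝ)) ≤ D := by
    have h1 : (2 : ℝ) ^ a ≤ (d : ℝ) ^ a :=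
      pow_le_pow_left₀ (by norm_num) (by exact_mod_cast hd2) a
    have h2 : (d : ℝ) ^ a ≤ D := by
      rw [hD]; exact pow_le_pow_right₀ (by exact_mod_cast hd1) (Nat.le_mul_of_pos_right a hn)
    have h3 : ((20 * a : ℕ) : ℝ) ≤ ((2 ^ a : ℕ) : ℝ) := by exact_mod_cast twenty_mul_le_two_pow ha8
    push_cast at h3
    linarith
  have hD1' : (1 : ℝ) ≤ D := by linarith
  have hA1 : (1 : ℝ) ≤ a * D := by
    have := mul_le_mul ha1' hD1' zero_le_one (by linarith : (0 : ℝ) ≤ a)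
    linarith
  have hA0 : (0 : ℝ) ≤ a * D := by linarith
  have hup : (a₀ : ℝ) * (d : ℝ) ^ (a₀ * n) ≤ a * D := by
    rw [hD]
    exact mul_le_mul (by exact_mod_cast ha0) (pow_le_pow_right₀ (by exact_mod_cast hd1)
      (Nat.mul_le_mul_right n ha0)) (by positivity) (by positivity)
  have hdgA : (g.natDegree : ℝ) ≤ a * D := hdegg.trans hup
  have hloglamA : Real.log lam ≤ a * D * Real.log ((w : ℝ) * x) :=
    hloglam.trans (mul_le_mul hup hlogwL hlogw0 hA0)
  have hlogwgA : Real.log (polyWeight g) ≤ a * D * Real.log ((w : ℝ) * x) :=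
    hlogwg.trans (mul_le_mul hup hlogwL hlogw0 hA0)
  have hdg1 : (1 : ℝ) ≤ g.natDegree := by exact_mod_cast hdg
  have hdgpos : (0 : ℝ) < g.natDegree := by linarith
  have hwg1 : (1 : ℝ) ≤ (polyWeight g : ℕ) := by exact_mod_cast one_le_polyWeight hirr.ne_zero
  have hwgpos : (0 : ℝ) < (polyWeight g : ℕ) := by linarith
  have hlogdg0 : 0 ≤ Real.log g.natDegree := Real.log_nonneg hdg1
  have hlogdgA : Real.log g.natDegree ≤ a * D := by
    have := Real.log_le_sub_one_of_pos hdgpos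
    linarith
  have hlogwg0 : 0 ≤ Real.log (polyWeight g : ℕ) := Real.log_nonneg hwg1
  -- the weak Corollary 4.8 for `g` (weight bound `wt(g)` itself)
  have h48g := h48 g (polyWeight g) hirr hdg le_rfl x
  rw [Real.log_mul (by positivity) hxpos.ne', Real.log_mul hdgpos.ne' hwgpos.ne'] at h48g
  -- Remark 4.6: `π_g ≤ π_S + ω(λ)`, and `ω(λ) log 2 ≤ log λ`
  have hcount : (rootModPrimeCount g x : ℝ) ≤
      solvableModPrimeCount S x + lam.primeFactors.card := by
    exact_mod_cast rootModPrimeCount_le S hlam v hirr hprim hgy hsolv x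
  have hω : (lam.primeFactors.card : ℝ) * (1 / 2) ≤ Real.log lam :=
    le_trans (mul_le_mul_of_nonneg_left hlog2 (Nat.cast_nonneg _))
      (card_primeFactors_mul_log_two_le hlam)
  -- the junk terms
  have hJ := thm41_junk (ω := (lam.primeFactors.card : ℝ)) hK0 hA1 hL2 hsx1 hdgA hlogdg0
    hlogdgA hlogwg0 hlogwgA hlogxL hloglamA hω
  -- the main term: `π(x)/(10 deg g) ≥ π(x)/(10 A)`
  have hmain : (Nat.primeCounting x : ℝ) / (10 * a * D) ≤
      (Nat.primeCounting x : ℝ) / (10 * g.natDegree) := by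
    rw [mul_assoc]
    exact div_le_div_of_nonneg_left hπ0 (by positivity) (by linarith)
  have hπS : (Nat.primeCounting x : ℝ) / (10 * a * D) -
      (K * (Real.sqrt x * (Real.log g.natDegree + Real.log (polyWeight g : ℕ) + Real.log x) +
        g.natDegree * (Real.log g.natDegree + Real.log (polyWeight g : ℕ))) +
        lam.primeFactors.card) ≤ solvableModPrimeCount S x := by
    linarith
  -- enlarge the junk bound from `(aD)²` to `(10aD)²`
  have hJ' : K * (Real.sqrt x * (Real.log g.natDegree + Real.log (polyWeight g : ℕ) + Real.log x) +
        g.natDegree * (Real.log g.natDegree + Real.log (polyWeight g : ℕ))) +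
        lam.primeFactors.card ≤ (7 * K + 2) * (10 * a * D) ^ 2 * (Real.sqrt x * Real.log ((w : ℝ) * x)) := by
    refine hJ.trans ?_
    have h100 : ((a : ℝ) * D) ^ 2 ≤ (10 * a * D) ^ 2 := by
      have e : (10 * (a : ℝ) * D) ^ 2 = 100 * ((a : ℝ) * D) ^ 2 := by ring
      rw [e]
      nlinarith [sq_nonneg ((a : ℝ) * D)]
    have hnn : 0 ≤ Real.sqrt x * Real.log ((w : ℝ) * x) := by positivity
    have hK2 : 0 ≤ 7 * K + 2 := by positivity
    exact mul_le_mul_of_nonneg_right (mul_le_mul_of_nonneg_left h100 hK2) hnn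
  -- absorb
  rw [show 4 * a * n = a * n * 4 by ring, pow_mul, ← hD]
  exact thm41_absorb (a := 10 * (a : ℝ)) (K₁ := 7 * K + 2) hπ0 (by linarith) hD20a
    (by positivity) hsx0 hL0 hπS0 hJ' hπS

end Literature.Computability.AlgebraicComplexity

end
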